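import Summits.ResolutionOfSingularities.ResolutionOfSingularities.Theorems.WeightedInvariantRatContactCanonical
import Summits.ResolutionOfSingularities.ResolutionOfSingularities.Theorems.WeightedInvariantJFlatEssSmoothLevels
import HarnessLib

/-!
# The rational one-flag filtration along essentially smooth local maps: transport, reflection, slope bookkeeping
# (door `HypersurfaceCentreConstruction`, stmt-ResolutionOfSingularities-19897; P3 rung; (o53-desc′) PART 1 = ONE-MEMBER /
# σ-RATIO DESCENT, brick 2a; hand res-L1-w43-stub-3)

Topic: `Summits/ResolutionOfSingularities/ResolutionOfSingularities/Theorems`. Helper for the door item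
`HypersurfaceCentreConstruction` (stmt-ResolutionOfSingularities-19897, route `WeightedInvariant`), line `local-engine` (L W4.3),
def-free.  Bookkeeping for the descent of `Iota3.RatContact.OneFlagReaches f ν a b` (`f ∈ ratContactFiltration g a b (aν)` for a
regular parameter `g`, port p560066) along a local homomorphism `φ : S → S'` with `𝔪S' = 𝔪'`:

* §1 transport: `map_ratContactFiltration` (`(RC_g) S' = RC_{φg}`), `algebraMap_mem_ratContactFiltration_iff` (faithful flatness,
  formally smooth case), `oneFlagReaches_algebraMap` (ascent).
* §2 slope bookkeeping: `ratContactFiltration_anti` (a larger slope reaches less: `RC(a₂,b)(a₂ν) ≤ RC(a₁,b)(a₁ν)` for `a₁ ≤ a₂`),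
  `ratContactFiltration_mul_eq_contactFiltration` (`RC_g(cb, b)(cbν) = contactFiltration g c (cν)`: integer slopes),
  `mem_span_pow_sup_of_ratContact_gt` (a slope `> c` reads `f ≡ a·g^ν` modulo `contactFiltration g c (cν + 1)`),
  `ratContactFiltration_eq_of_sub_unit_mul_mem_pow` (`g₁ − u g₂ ∈ 𝔪^⌈a/b⌉`, `u` a unit ⇒ equal filtrations),
  `oneFlagReaches_of_le` (slopes `≤ 1` are reached by every parameter).

[OURS · L1 W4.3 · (o53-desc′) PART 1]  Replaces the role of NO printed item; NOT a statement of the manuscript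
[claim: Hironaka2017, status: under-review]. AI work, weaker than expert review.  Pure commutative algebra; no named facts.

## References

* H. Hironaka, *Characteristic polyhedra of singularities*, J. Math. Kyoto Univ. 7 (1967). [Hironaka1967]
* A. Grothendieck, *EGA IV*, Publ. Math. IHÉS 20 (1964), 0_IV (19.7.1), (17.5.1). [EGA0IV]
-/

noncomputable section

open IsLocalRing Literature.AlgebraicGeometry.Resolution
open Summit.ResolutionOfSingularities.ResolutionOfSingularities.Cruxes.HypersurfaceCentreConstruction.LocalEngine
open Summit.ResolutionOfSingularities.ResolutionOfSingularities.Cruxes.HypersurfaceCentreConstruction.LocalEngine.Iota3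
open Summit.ResolutionOfSingularities.ResolutionOfSingularities.Cruxes.HypersurfaceCentreConstruction.LocalEngine.Iota3.RatContact

set_option linter.dupNamespace false -- mandated namespace of this single-conjunct summit

namespace Summit.ResolutionOfSingularities.ResolutionOfSingularities.Theorems

namespace RatContactEssSmooth

/-! ## §1 Transport and reflection -/

section Transport

variable {S S' : Type} [CommRing S] [CommRing S'] [IsLocalRing S] [IsLocalRing S'] [Algebra S S']

/-- **Extension of the rational filtration**: `𝔪 S' = 𝔪'` ⇒ `(RC_g(a,b)(n)) S' = RC_{φ g}(a,b)(n)`. [folklore] -/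
theorem map_ratContactFiltration (h𝔪 : (maximalIdeal S).map (algebraMap S S') = maximalIdeal S') (g : S) (a b n : ℕ) :
    (ratContactFiltration g a b n).map (algebraMap S S') = ratContactFiltration (algebraMap S S' g) a b n := by
  simp only [ratContactFiltration_def, Ideal.map_iSup, Ideal.map_mul, Ideal.map_pow, Ideal.map_span,
    Set.image_singleton, map_pow, h𝔪]

end Transport

section Reflect

variable {S S' : Type} [CommRing S] [CommRing S'] [IsRegularLocalRing S] [IsRegularLocalRing S'] [Algebra S S']
  [IsLocalHom (algebraMap S S')] [Algebra.FormallySmooth S S'] [Algebra.EssFiniteType S S']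

/-- Ascent of a one-flag reach along a flat local map with `𝔪S' = 𝔪'` between regular local rings (the parameter stays
outside `𝔪'²` by `mem_maximalIdeal_pow_iff_of_formallySmooth`). [cite: EGA0IV, 0_IV (19.7.1)] -/
theorem oneFlagReaches_algebraMap (h𝔪 : (maximalIdeal S).map (algebraMap S S') = maximalIdeal S') {f : S} {ν a b : ℕ}
    (h : OneFlagReaches f ν a b) : OneFlagReaches (algebraMap S S' f) ν a b := by
  obtain ⟨g, hg, hg2, hf⟩ := h
  refine ⟨algebraMap S S' g, ?_, ?_, ?_⟩
  · exact h𝔪 ▸ Ideal.mem_map_of_mem _ hg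
  · exact fun h2 => hg2 ((IotaOrderEssSmooth.mem_maximalIdeal_pow_iff_of_formallySmooth S S' 2 g).mpr h2)
  · rw [← map_ratContactFiltration h𝔪]
    exact Ideal.mem_map_of_mem _ hf

/-- Membership in the rational filtration is preserved and reflected (faithful flatness). [cite: EGA0IV, 0_IV (19.7.1)] -/
theorem algebraMap_mem_ratContactFiltration_iff (h𝔪 : (maximalIdeal S).map (algebraMap S S') = maximalIdeal S')
    (f g : S) (a b n : ℕ) :
    algebraMap S S' f ∈ ratContactFiltration (algebraMap S S' g) a b n ↔ f ∈ ratContactFiltration g a b n := by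
  rw [← map_ratContactFiltration h𝔪]
  exact ⟨EssSmoothDescent.mem_of_algebraMap_mem_map, Ideal.mem_map_of_mem _⟩

end Reflect

/-! ## §2 Slope bookkeeping -/

section Slopes

variable {S : Type} [CommRing S] [IsLocalRing S]

/-- Ceilings are monotone: `x ≤ y` ⇒ `⌈x/b⌉ ≤ ⌈y/b⌉`. [folklore] -/
theorem ceilDiv_mono {x y b : ℕ} (h : x ≤ y) : (x + b - 1) / b ≤ (y + b - 1) / b :=
  Nat.div_le_div_right (by omega)

/-- **A larger slope reaches less**: for `a₁ ≤ a₂`, `RC_g(a₂,b)(a₂ν) ≤ RC_g(a₁,b)(a₁ν)` (piecewise: `⌈a₂(ν−α)/b⌉ ≥ ⌈a₁(ν−α)/b⌉`).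
[folklore] -/
theorem ratContactFiltration_anti (g : S) {a₁ a₂ : ℕ} (ha : a₁ ≤ a₂) (b ν : ℕ) :
    ratContactFiltration g a₂ b (a₂ * ν) ≤ ratContactFiltration g a₁ b (a₁ * ν) := by
  rw [ratContactFiltration_def, ratContactFiltration_def]
  refine iSup_le fun α => le_iSup_of_le α (Ideal.mul_mono_right (Ideal.pow_le_pow_right (ceilDiv_mono ?_)))
  rw [← mul_tsub, ← mul_tsub]
  exact Nat.mul_le_mul_right _ ha

/-- **Integer slopes**: `RC_g(cb, b)(cbν) = contactFiltration g c (cν)` for `0 < b` (piecewise `⌈cb(ν−α)/b⌉ = c(ν−α)`). [folklore] -/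
theorem ratContactFiltration_mul_eq_contactFiltration (g : S) (c : ℕ) {b : ℕ} (hb : 0 < b) (ν : ℕ) :
    ratContactFiltration g (c * b) b (c * b * ν) = contactFiltration g c (c * ν) := by
  rw [ratContactFiltration_def, contactFiltration_def]
  refine iSup_congr fun α => ?_
  congr 2
  have e1 : c * b * ν - c * b * α = (c * ν - c * α) * b := by
    rw [← mul_tsub, ← mul_tsub, mul_right_comm]
  rw [e1]
  have e2 : ((c * ν - c * α) * b + b - 1) / b = c * ν - c * α := by
    have := Nat.mul_add_div hb (c * ν - c * α) (b - 1)
    rw [Nat.div_eq_of_lt (Nat.sub_lt hb Nat.one_pos), add_zero, mul_comm b] at this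
    rwa [Nat.add_sub_assoc hb]
  rw [e2]

/-- **A slope `> c` read at level `c`**: `f ∈ RC_g(a', b')(a'ν)` with `c b' < a'` ⇒ `f ∈ (g^ν) + contactFiltration g c (cν + 1)`
(pieces `α ≥ ν` are multiples of `g^ν`; for `α < ν`, `⌈a'(ν−α)/b'⌉ ≥ c(ν−α) + 1`). [folklore] -/
theorem mem_span_pow_sup_of_ratContact_gt (g : S) {a' b' c : ℕ} (hb' : 0 < b') (hslope : c * b' < a') (ν : ℕ) {f : S}
    (hf : f ∈ ratContactFiltration g a' b' (a' * ν)) :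
    f ∈ Ideal.span {g ^ ν} ⊔ contactFiltration g c (c * ν + 1) := by
  have hle : ratContactFiltration g a' b' (a' * ν) ≤ Ideal.span {g ^ ν} ⊔ contactFiltration g c (c * ν + 1) := by
    rw [ratContactFiltration_def, contactFiltration_def]
    refine iSup_le fun α => ?_
    by_cases hα : ν ≤ α
    · refine le_sup_of_le_left (le_trans Ideal.mul_le_right ?_)
      exact Ideal.span_singleton_le_span_singleton.mpr (pow_dvd_pow g hα)
    · push Not at hα
      refine le_sup_of_le_right (le_iSup_of_le α (Ideal.mul_mono_right (Ideal.pow_le_pow_right ?_)))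
      -- `c ν + 1 - c α ≤ ⌈a'(ν - α)/b'⌉`
      have hm : 1 ≤ ν - α := by omega
      have h1 : c * (ν - α) + 1 ≤ (a' * (ν - α) + b' - 1) / b' := by
        rw [Nat.mul_comm c b'] at hslope
        exact RatContactCanonical.succ_mul_le_ceil hb' hslope hm
      have e1 : a' * ν - a' * α = a' * (ν - α) := (mul_tsub a' ν α).symm
      have e2 : c * (ν - α) = c * ν - c * α := mul_tsub c ν α
      rw [e1]
      omega
  exact hle hf

/-- **Congruent parameters have the same rational filtration**: `g₁ − u g₂ ∈ 𝔪^⌈a/b⌉` with `u` a unit ⇒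
`RC_{g₁}(a,b)(n) = RC_{g₂}(a,b)(n)` for all `n` (dominance both ways, `RatContactCanonical.ratContactFiltration_le_of_mem_span_sup_pow`).
[folklore] -/
theorem ratContactFiltration_eq_of_sub_unit_mul_mem_pow {g₁ g₂ : S} {u : S} (hu : IsUnit u) {a b : ℕ} (hb : 0 < b)
    (h : g₁ - u * g₂ ∈ maximalIdeal S ^ ((a + b - 1) / b)) (n : ℕ) :
    ratContactFiltration g₁ a b n = ratContactFiltration g₂ a b n := by
  refine le_antisymm (RatContactCanonical.ratContactFiltration_le_of_mem_span_sup_pow hb ?_ n)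
    (RatContactCanonical.ratContactFiltration_le_of_mem_span_sup_pow hb ?_ n)
  · -- `g₁ = u g₂ + (g₁ - u g₂)`
    have : g₁ = u * g₂ + (g₁ - u * g₂) := by ring
    rw [this]
    exact Submodule.add_mem_sup (Ideal.mem_span_singleton'.mpr ⟨u, rfl⟩) h
  · -- `g₂ = u⁻¹ g₁ - u⁻¹ (g₁ - u g₂)`
    obtain ⟨v, rfl⟩ := hu
    have : g₂ = (↑v⁻¹ : S) * g₁ + -(↑v⁻¹ * (g₁ - v * g₂)) := by
      rw [mul_sub, ← mul_assoc, Units.inv_mul, one_mul]; ring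
    rw [this]
    exact Submodule.add_mem_sup (Ideal.mem_span_singleton'.mpr ⟨_, rfl⟩)
      (neg_mem (Ideal.mul_mem_left _ _ h))

/-- **Slopes `≤ 1` are free**: for `a ≤ b`, `0 < b`, `f ∈ 𝔪^ν` and ANY `g`, `f ∈ RC_g(a,b)(aν)` (the piece `α = 0` is `𝔪^⌈aν/b⌉ ⊇ 𝔪^ν`).
[folklore] -/
theorem mem_ratContactFiltration_of_le (g : S) {a b : ℕ} (hab : a ≤ b) (hb : 0 < b) {f : S} {ν : ℕ}
    (hf : f ∈ maximalIdeal S ^ ν) : f ∈ ratContactFiltration g a b (a * ν) := by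
  rw [ratContactFiltration_def]
  have hle : maximalIdeal S ^ ν ≤ Ideal.span {g ^ 0} * maximalIdeal S ^ ((a * ν - a * 0 + b - 1) / b) := by
    rw [pow_zero, Ideal.span_singleton_one, Ideal.top_mul, mul_zero, Nat.sub_zero]
    refine Ideal.pow_le_pow_right ?_
    -- `⌈aν/b⌉ ≤ ν`
    apply Nat.le_of_lt_succ
    rw [Nat.div_lt_iff_lt_mul hb]
    have h1 : a * ν ≤ b * ν := Nat.mul_le_mul_right ν hab
    have e : (ν + 1) * b = b * ν + b := by ring
    rw [Nat.succ_eq_add_one, e]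
    generalize a * ν = d at h1 ⊢
    generalize b * ν = d' at h1 ⊢
    omega
  exact (le_iSup (fun α => Ideal.span {g ^ α} * maximalIdeal S ^ ((a * ν - a * α + b - 1) / b)) 0) (hle hf)

/-- **Slopes `≤ 1` are free** (reach form): in a local ring with a parameter `g ∈ 𝔪 ∖ 𝔪²`, every `f ∈ 𝔪^ν` satisfies
`OneFlagReaches f ν a b` for `a ≤ b`, `0 < b`. [folklore] -/
theorem oneFlagReaches_of_le {g : S} (hg : g ∈ maximalIdeal S) (hg2 : g ∉ maximalIdeal S ^ 2) {a b : ℕ} (hab : a ≤ b)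
    (hb : 0 < b) {f : S} {ν : ℕ} (hf : f ∈ maximalIdeal S ^ ν) : OneFlagReaches f ν a b :=
  ⟨g, hg, hg2, mem_ratContactFiltration_of_le g hab hb hf⟩

/-- Ceiling steps: `b ∤ a`, `0 < b` ⇒ `⌈(a+1)/b⌉ = ⌈a/b⌉`. [folklore] -/
theorem ceilDiv_succ_of_not_dvd {a b : ℕ} (hb : 0 < b) (hnd : ¬ b ∣ a) : (a + 1 + b - 1) / b = (a + b - 1) / b := by
  -- `a = qb + r` with `0 < r < b`
  have hr : 0 < a % b := Nat.pos_of_ne_zero fun h => hnd (Nat.dvd_of_mod_eq_zero h)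
  have hrb : a % b < b := Nat.mod_lt a hb
  have hdecomp := Nat.div_add_mod a b
  have e1 : (a + b - 1) / b = a / b + 1 := by
    have h1 : a + b - 1 = (a % b + (b - 1)) + b * (a / b) := by omega
    have h2 : (a % b + (b - 1)) / b = 1 := Nat.div_eq_of_lt_le (by omega) (by omega)
    rw [h1, Nat.add_mul_div_left _ _ hb, h2, Nat.add_comm]
  have e2 : (a + 1 + b - 1) / b = a / b + 1 := by
    have h1 : a + 1 + b - 1 = (a % b + b) + b * (a / b) := by omega
    have h2 : (a % b + b) / b = 1 := Nat.div_eq_of_lt_le (by omega) (by omega)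
    rw [h1, Nat.add_mul_div_left _ _ hb, h2, Nat.add_comm]
  rw [e1, e2]

/-- Ceiling steps: `b ∣ a`, `0 < b` ⇒ `⌈(a+1)/b⌉ = a/b + 1` and `⌈a/b⌉ = a/b`. [folklore] -/
theorem ceilDiv_succ_of_dvd {a b : ℕ} (hb : 0 < b) (hd : b ∣ a) :
    (a + 1 + b - 1) / b = a / b + 1 ∧ (a + b - 1) / b = a / b := by
  obtain ⟨c, rfl⟩ := hd
  rw [Nat.mul_div_cancel_left c hb]
  constructor
  · have : b * c + 1 + b - 1 = b + b * c := by omega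
    rw [this, Nat.add_mul_div_left _ _ hb, Nat.div_self hb, Nat.add_comm]
  · have : b * c + b - 1 = (b - 1) + b * c := by omega
    rw [this, Nat.add_mul_div_left _ _ hb, Nat.div_eq_of_lt (Nat.sub_lt hb Nat.one_pos), Nat.zero_add]

end Slopes

end RatContactEssSmooth

end Summit.ResolutionOfSingularities.ResolutionOfSingularities.Theorems

end
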